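import Mathlib
import HarnessLib
import HarnessLib.Audit
import Summits.NavierStokesRegularity.Statement
import Literature.Analysis.FluidPDE.MaximalEnstrophy
import Literature.Analysis.FluidPDE.EnstrophyBudgetContinuity
import Literature.Analysis.FluidPDE.TaoBoundedEnstrophyLerayH1
import Literature.Analysis.FluidPDE.TaoLocalisation
import Summits.NavierStokesRegularity.NavierStokesRegularity.Theorems.ContinuousAlignmentNoBlowupToClay
import HarnessLib.Audit.Status.Attr

/-!
Route: ExtremalEnstrophy

# Route ExtremalEnstrophy — finite-horizon maximal enstrophy as induction budget; only exact
maximisers need an estimate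

X = MaximiserRigidity ∧ CompactnessDichotomy ∧ SplittingBound ("it suffices to show X"; card
extremal-enstrophy-rigidity, spine).
Fix ν > 0 and let 𝒵(E, Z, T) = `Literature.Analysis.FluidPDE.maxEnstrophy ν E Z T` be the largest
enstrophy ‖∇u(t)‖² reached at a
time t ≤ T by a Leray–Hopf trajectory whose datum has energy ≤ E and enstrophy ≤ Z (an ℝ≥0∞-valued,
monotone value function; the
Lu–Doering / Ayala–Protas / Kang–Yun–Protas extreme-vortex-states object, finite-horizon version).
Clay (A) follows from
𝒵(E, ·, T) < ∞, proved by INDUCTION ON THE BUDGET Z against the strictly superadditive majorant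
Φ_C(E, Z) = C·Z·(1 + √(E Z)):
at the first budget where 𝒵 touches Φ, a maximising sequence either is attained
(CompactnessDichotomy, soft) — and an EXACT
finite-time maximiser obeys 𝒵 ≤ Φ/2 (MaximiserRigidity, the one hard estimate, via symmetry
inheritance V2a and the swirl-free law
V2b) — or splits into profiles each with budget ≤ Z − γ₀, whose flows decouple (SplittingBound), and
superadditivity of Φ leaves a
positive margin. No estimate is ever asked of a generic trajectory.
Lean: `MaximiserRigidity ∧ CompactnessDichotomy ∧ SplittingBound`

## Assembly
glue.lean `closes` (lean check rc 0, 0 sorry, axioms propext / Classical.choice / Quot.sound)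
consumes ALL eight items (every statement uniform in ν > 0): the abstract
minimal-budget lemma `Literature.Analysis.FluidPDE.lt_top_of_budget_dichotomy` with f Z := 𝒵(E,Z,T),
Φ := enstrophyMajorant C E,
A := attained, B := split family, z₀ := κ/E — base case SmallBudgetMonotone +
`le_enstrophyMajorant`, semicontinuity S2/S3,
dichotomy CompactnessDichotomy, branch A excluded by MaximiserRigidity (Φ/2 < Φ), branch B by
SplittingBound +
`enstrophyMajorant_gap_coe` (strict superadditivity margin `enstrophyMargin`) — gives 𝒵(E, ·, T) <
∞; then for a classical
Leray–Hopf solution from Clay data `eWeakGradL2Sq_le_maxEnstrophy` bounds the enstrophy on [0,T),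
EnstrophyContinuation extends it,
NoBlowupToClay concludes. The Assembly item below is the curried form of `closes`.

Rationale: WHY THIS LINE. The extreme-vortex-states programme (LuDoering2008: the instantaneous bound dZ/dt ≤ c
Z³/ν³ is sharp; AyalaProtas2017,
KangYunProtas2020: finite-time maximisers exist numerically and realise growth ≈ C Z₀^(3/2), far
below the singular bound;
RamirezProtas2026) has produced objects but no regularity mechanism, because integrating the sharp
instantaneous rate caps the method
at small data. This line makes the finite-horizon value function itself the induction parameter
(imported: critical-element /
budget induction of KenigMerle2006 and profile decompositions Gerard1998, Gallagher2001, Lions1984 —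
from dispersive PDE — but run on
the SUBCRITICAL quantity Z at fixed energy, where the local theory is elementary,
Kato1984/FujitaKato1964) and a strictly
superadditive majorant, so that the only place an inequality must be proved is at an exact, attained
finite-time maximiser, an object
with Euler–Lagrange/KKT structure and (conjecturally, V2a) axisymmetric swirl-free symmetry, where
the transport of ω_θ/r gives
global control (LemarieRieusset2016 Thm 10.4; tree fact axisymmetricNoSwirl_enstrophy_apriori).
Prior hub routes put extremal or
minimal objects in CRITICAL settings (AxisymmetricExtremality: Rusin–Šverák minimal blow-up data;
MarginalTypeI /
MinimalBlowupRigidity: Kenig–Merle in Ḣ^½; ExtremalTypeIConstant): here the extremal object is a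
finite-time enstrophy maximiser at
finite budget, which exists BEFORE any blow-up and is accessible to certified numerics; none of the
five negatives of the summit
concerns it.

RANKED CRUXES. #2 MaximiserRigidity (crux) — V2 — for every ν > 0 there is C = C(ν) ≥ 1 such that
for all budgets E, Z > 0 and horizons T > 0 with 𝒵(E,Z,T) < ∞, every EXACT maximiser (a Leray–Hopf
trajectory from data with energy ≤ E, enstrophy ≤ Z whose enstrophy at some t ≤ T equals 𝒵(E,Z,T))
has that enstrophy ≤ Φ_C(E,Z)/2 = C·Z·(1+√(EZ))/2 (card K2: symmetry inheritance V2a + swirl-free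
law V2b). [difficulty: XL] (why it might fail: if finite-time maximisers are not swirl-free
axisymmetric (extended maximisers of arXiv:2604.13338 lose symmetry) V2 is the full a-priori bound
at the worst datum ≈ S; even swirl-free, an (E,Z)-uniform law is unproved since ω_θ/r ∉ L² for H¹
data.) [LuDoering2008, AyalaProtas2017, KangYunProtas2020, RamirezProtas2026, LemarieRieusset2016]
#3 CompactnessDichotomy (crux) — V1 — at every level (E,Z,T) with 𝒵 < ∞, either the maximal
enstrophy is attained by an exact maximiser, or there is a uniform gain γ₀ > 0 such that for every ε
> 0 some maximising sequence profile-splits (translations only, frames diverging, weakly orthogonal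
remainder with limsup ‖r_n‖_L³ ≤ ε, budgets orthogonal) with every profile of enstrophy ≤ Z − γ₀
(card K1: H¹ profile decomposition + compact ⇒ attained on the closed window). [difficulty: L] (why
it might fail: vanishing maximising data (Lions): enstrophy may spread over J → ∞ weak bubbles each
below any fixed size, giving neither one compact profile nor finitely many profiles with a uniform
gain γ₀ while the L³-small remainder keeps Ḣ¹ mass ≈ Z.) [Lions1984, Gerard1998, Gallagher2001,
KenigMerle2006]
#4 SplittingBound (crux) — V3 — at every finite level and for every γ > 0 there is ε > 0 such that
along any ε-profile-split sequence the peak enstrophy is asymptotically at most the sum of the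
pieces' maximal enstrophies 𝒵(E, Z(φ_j), T) plus the remainders' enstrophy plus γ (card K3:
nonlinear profile decomposition / asymptotic decoupling of far-apart profiles and an L³-small
remainder in the subcritical H¹ class). [deps: CompactnessDichotomy] [difficulty: L] (why it might
fail: an L³-small but Ḣ¹-large remainder is strained by the profiles' flow; enstrophy transfer
profile → remainder over [0,T] need not vanish as ε → 0 (only a critical norm is small), so the peak
may exceed the decoupled sum by O(1), not γ.) [Gallagher2001, Kato1984, KenigMerle2006, Gerard1998]
#9 SmallBudgetMonotone (support) — S1 — small data: for every ν > 0 there is κ = κ(ν) > 0 such that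
E·Z ≤ κ implies 𝒵(E,Z,T) ≤ Z for all T (enstrophy is non-increasing for Leray–Hopf trajectories from
data with ‖u₀‖₂‖∇u₀‖₂ small; weak–strong uniqueness). [difficulty: M] [FujitaKato1964, Kato1984,
RobinsonRodrigoSadowski2016]
#9 BudgetUpperSemicontinuity (support) — S2 — at a finite level, 𝒵(E, Z+δ, T) ≤ 𝒵(E,Z,T) + η for
some δ = δ(η) > 0 (right upper semicontinuity of the value function in the enstrophy budget; H¹
stability of the strong flow under the a-priori bound given by finiteness of the level, plus the
parabolic scaling 𝒵(E, λZ, T) = λ𝒵(λE, Z, λ²T)). [difficulty: M] [KangYunProtas2020,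
RobinsonRodrigoSadowski2016, FujitaKato1964]
#9 BudgetLowerSemicontinuity (support) — S3 — every value below 𝒵(E,Z,T) is exceeded at some
strictly smaller enstrophy budget Z' < Z (left lower semicontinuity; shrink the datum of a
near-maximising trajectory and use H¹ continuity of the strong flow up to the observation time).
[difficulty: M] [KangYunProtas2020, RobinsonRodrigoSadowski2016, FujitaKato1964]
#9 EnstrophyContinuation (support) — S4 — a classical solution on [0,T) that is Leray–Hopf on [0,T]
and has enstrophy bounded on [0,T) extends smoothly past T (H¹ local theory with lifespan depending
on the enstrophy only; Serrin/weak–strong uniqueness). [difficulty: provable-now] [FujitaKato1964,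
RobinsonRodrigoSadowski2016, LemarieRieusset2016]
#9 NoBlowupToClay (support) — S5 — if every classical Leray–Hopf solution from a rapidly decaying
datum extends past every finite time then Clay (A) holds (shared frame item
stmt-NavierStokesRegularity-0055, already proved in Theorems/TypeICertificateLadderNoBlowupToClay).
[difficulty: provable-now] [FujitaKato1964, Kato1984, LemarieRieusset2016]

TWO-LAYER PLAN. Foreseen glued splits (nothing filed now): MaximiserRigidity ⇐ MaximiserSymmetry
(V2a: exact maximisers are axisymmetric swirl-free
up to rigid motion) → SwirlFreeMaximiserLaw (V2b: Φ/2 bound for swirl-free maximisers) →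
MaximiserRigidity (skeleton
bc/MaximiserRigidity_birth.lean); CompactnessDichotomy ⇐ ProfileExtraction → CompactAttained →
CompactnessDichotomy; SplittingBound ⇐
RemainderDecay (small-L³ data do not grow enstrophy) → AsymptoticDecoupling → SplittingBound.

KILL CRITERIA. A certified or numerically converged family of finite-time maximisers with
𝒵(E,Z,T)/[Z(1+√(EZ))] unbounded, or exact maximisers that
are provably non-axisymmetric with growth beating every swirl-free law, refutes MaximiserRigidity —
close `refuted:MaximiserRigidity`
unless only the SHAPE of Φ is wrong (then restate with another strictly superadditive majorant: the
glue needs only monotonicity +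
a positive splitting margin). A vanishing maximising sequence (no profile, no attainment) refutes
CompactnessDichotomy and kills the
induction outright. SplittingBound refuted by an interacting profile/remainder pair ⇒ pivot to a
split predicate carrying an
interaction budget (new crux) or close. NoBlowup proved elsewhere moots the route; a blow-up (¬S)
makes 𝒵 = ∞ at some finite level and
refutes MaximiserRigidity ∧ CompactnessDichotomy ∧ SplittingBound jointly.

NOT DECOMPOSED YET. V2a/V2b (symmetry inheritance, swirl-free law) stay stubs of the
MaximiserRigidity skeleton, not items; the KKT/adjoint system of a
finite-time maximiser, second-variation arguments, and the constant C are prover-side; the H¹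
profile decomposition lemma and the
small-L³ enstrophy decay are stubs of the V1/V3 skeletons; ν-rescaling identities and the H¹
continuation are supports, provable now.

CHEAPEST FALSIFIER. Kit job (not run this cycle — it is a PDE-constrained optimisation, beyond a
quick script): Kang–Yun–Protas adjoint ascent for
max_T ‖∇u(T)‖² on 𝕋³/ℝ³ at 4–6 budgets (E,Z), once unconstrained and once restricted to axisymmetric
swirl-free fields; KILL if the
unconstrained optimum strictly beats the swirl-free one (V2a dead ⇒ V2 ≈ S) or if the optimal growth
ratio 𝒵/[Z(1+√(EZ))] drifts upward
across budgets. Cheaper lookup already done: KangYunProtas2020 report finite-time maximal growth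
scaling ≈ Z₀^1.5 (= the Φ law at fixed
E) and ring-like optimal data; RamirezProtas2026 (arXiv:2604.13338) report symmetry loss for
extended maximisers — mixed evidence,
hence rank 2.

NUMBERS. Instantaneous sharp rate dZ/dt ≤ (27/(8π⁴ν³))·Z³ attained up to constants by Lu–Doering
maximisers (LuDoering2008; Doering–Gibbon
1995 §7.3 pp. 118–119: exponent 3 is dimensionally forced, no absorbing ball beyond small data);
finite-time maximal growth
≈ 0.1–0.2·Z₀^(3/2) numerically (KangYunProtas2020); small-data threshold E·Z ≲ c ν⁴ (classical).
Items at open: 9 (3 cruxes, 5 supports, 1 assembly).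

DEFINITION REQUESTS. None outstanding: `maxEnstrophy`, `IsLerayHopfTrajectory`,
`IsMaxEnstrophyAttained`, `ProfileSplitData`, `IsProfileSplitSequence`
landed in Literature/Analysis/FluidPDE/MaximalEnstrophy.lean (p169491, c77e570ba853) and
`enstrophyMajorant`, `enstrophyMargin`,
`enstrophyMajorant_gap(_coe)`, `lt_top_of_budget_dichotomy` in
Literature/Analysis/FluidPDE/EnstrophyBudgetContinuity.lean (p169609,
e4e53712e94e).

Novelty: Searches (2026-08-17): `lit search --hybrid "maximal enstrophy growth finite time Navier-Stokes
extreme vortex states"` and `"sharp enstrophy growth bound maximal finite-time Navier-Stokes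
regularity small data"` (8 docs each; [corpus:doering1995-applied-analysis-navier-stokes-equations
pp.118–119] sharp instantaneous rate, no finite-time law); `lit vsearch "finite-time maximal
enstrophy bounded by C Z (1+sqrt(E Z)) for exact maximisers"` (books only: Frisch, Doering–Gibbon,
Majda–Bertozzi — no paper states a finite-time law); `lit galaxy search "maximum enstrophy
growth|maximal enstrophy|extreme vortex states" --star all` (7 rows:
[galaxy:pdf:7672074237338834780] Fantuzzi–Goluskin convex-optimisation bounds on extreme events,
[galaxy:pdf:5946811384796685560] Ayala–Doering–Simon 2-D palinstrophy,
[galaxy:pdf:4770308468448022320] Farazmand–Sapsis); `lean search maxEnstrophy|enstrophyMajorant`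
(only this route's modules); `ledger negatives --problem NavierStokesRegularity` (5, none on
enstrophy maximisation); hub routes read: AxisymmetricExtremality, ExtremalTypeIConstant,
MinimalBlowupRigidity (closed), MarginalTypeI.
Nearest prior art found: LuDoering2008 / AyalaProtas2017 / KangYunProtas2020 / RamirezProtas2026
(extreme vortex states: sharp instantaneous bound, numerical finite-time maximisers, no regularity
mechanism); [galaxy:pdf:7672074237338834780] (auxiliary-functional upper bounds on
sup-over-trajectories functionals, Burgers only); KenigMerle2006 (critical-element ind  [refs: LuDoering2008, AyalaProtas2017, KangYunProtas2020, RamirezProtas2026, KenigMerle2006]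

Barriers (technique_class: extremal-enstrophy, variational, budget-induction): - technique_class: extremal-enstrophy, variational, budget-induction, energy-methods,
supercritical-a-priori-control, large-data-compactness-from-energy-bounds
- Literature.Barriers.NavierStokesRegularity.EnergySupercriticality: energy and cumulative
dissipation are never used coercively across scales; the controlled quantity is the subcritical
value function 𝒵(E,Z,T), made finite by induction on Z, the estimate entering only at exact
maximisers — for MaximiserRigidity itself it does not evade the heuristic; the bet is V2a (symmetry
of maximisers) making the swirl-free structure available.
- Literature.Barriers.NavierStokesRegularity.TaoAveragedBlowup: CompactnessDichotomy, SplittingBound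
and S1–S5 are soft/perturbative and hold for averaged equations too, claiming no regularity;
MaximiserRigidity is FALSE for Tao's averaged system (his cascade is an unbounded maximising
family), so its proof must and does route through non-averaged structure: the transport identity for
ω_θ/r of swirl-free flows (V2b) after symmetry inheritance (V2a), algebra the averaged bilinear
forms do not possess.
- Literature.Barriers.NavierStokesRegularity.NavierStokesInequalitySingularSolution: not a
local-energy-inequality argument — exact maximisers solve the Navier–Stokes EQUALITY and V2a uses
their Euler–Lagrange/KKT system, unavailable for Scheffer's NSI supersolutions.
- Literature.Barriers.NavierStokesRegularity.CriticalNormBlowupNecessity: negative-side entry,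
consistent with the line (𝒵 = ∞ a

sub-problem: NavierStokesRegularity · status: draft · opened planner-type-f5c3e9fad0-0 2026-08-17T16:55:31Z · rev 0 · ledger route-NavierStokesRegularity-ExtremalEnstrophy
GENERATED by the gate from the ledger (D-0016/17). Provers cite these decls: `theorem foo : Summit.NavierStokesRegularity.NavierStokesRegularity.Theses.ExtremalEnstrophy.<Decl> := …` in Summits/NavierStokesRegularity/NavierStokesRegularity/Theorems/<Name>.lean.
-/

namespace Summit.NavierStokesRegularity.NavierStokesRegularity.Theses.ExtremalEnstrophy

open scoped BigOperators Topology Manifold Classical MeasureTheory ProbabilityTheory Matrix InnerProductSpace ComplexConjugate ContinuousMap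
open Filter Set Function TopologicalSpace MeasureTheory

attribute [summit_statement] _root_.NavierStokesRegularity

open Literature.NS

/-- item stmt-NavierStokesRegularity-18663 · crux · rank 2 · open · by planner
why it might fail: if finite-time maximisers are not swirl-free axisymmetric (extended maximisers of arXiv:2604.13338 lose symmetry) V2 is the full a-priori bound at the worst datum ≈ S; even swirl-free, an (E,Z)-uniform law is unproved since ω_θ/r ∉ L² for H¹ data.
sources: LuDoering2008, AyalaProtas2017, KangYunProtas2020, RamirezProtas2026, LemarieRieusset2016
[crux] V2 — for every ν > 0 there is C = C(ν) ≥ 1 such that for all budgets E, Z > 0 and horizons T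
> 0 with 𝒵(E,Z,T) < ∞, every EXACT maximiser (a Leray–Hopf trajectory from data with energy ≤ E,
enstrophy ≤ Z whose enstrophy at some t ≤ T equals 𝒵(E,Z,T)) has that enstrophy ≤ Φ_C(E,Z)/2 =
C·Z·(1+√(EZ))/2 (card K2: symmetry inheritance V2a + swirl-free law V2b). [difficulty: XL] -/
@[route_item "route-NavierStokesRegularity-ExtremalEnstrophy", crux]
def MaximiserRigidity : Prop :=
  ∀ ν : ℝ, 0 < ν → ∃ C : NNReal, 1 ≤ C ∧ ∀ (E Z : NNReal) (T : ℝ), 0 < E → 0 < Z → 0 < T → Literature.Analysis.FluidPDE.maxEnstrophy ν E Z T < ⊤ → ∀ (T' : ℝ) (u : ℝ → EuclideanSpace ℝ (Fin 3) → EuclideanSpace ℝ (Fin 3)) (t : ℝ), Literature.Analysis.FluidPDE.IsLerayHopfTrajectory ν T' u → Literature.Analysis.FluidPDE.eEnergy (u 0) ≤ E → Literature.Analysis.FluidPDE.eWeakGradL2Sq (u 0) ≤ Z → 0 ≤ t → t ≤ T → t < T' → Literature.Analysis.FluidPDE.eWeakGradL2Sq (u t) = Literature.Analysis.FluidPDE.maxEnstrophy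 ν E Z T → Literature.Analysis.FluidPDE.eWeakGradL2Sq (u t) ≤ (Literature.Analysis.FluidPDE.enstrophyMajorant C E Z : ENNReal) / 2

/-- item stmt-NavierStokesRegularity-18664 · crux · rank 3 · open · by planner
why it might fail: vanishing maximising data (Lions): enstrophy may spread over J → ∞ weak bubbles each below any fixed size, giving neither one compact profile nor finitely many profiles with a uniform gain γ₀ while the L³-small remainder keeps Ḣ¹ mass ≈ Z.
sources: Lions1984, Gerard1998, Gallagher2001, KenigMerle2006
[crux] V1 — at every level (E,Z,T) with 𝒵 < ∞, either the maximal enstrophy is attained by an exact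
maximiser, or there is a uniform gain γ₀ > 0 such that for every ε > 0 some maximising sequence
profile-splits (translations only, frames diverging, weakly orthogonal remainder with limsup
‖r_n‖_L³ ≤ ε, budgets orthogonal) with every profile of enstrophy ≤ Z − γ₀ (card K1: H¹ profile
decomposition + compact ⇒ attained on the closed window). [difficulty: L] -/
@[route_item "route-NavierStokesRegularity-ExtremalEnstrophy", crux]
def CompactnessDichotomy : Prop :=
  ∀ ν : ℝ, 0 < ν → ∀ (E Z : NNReal) (T : ℝ), 0 < E → 0 < Z → 0 < T → Literature.Analysis.FluidPDE.maxEnstrophy ν E Z T < ⊤ → Literature.Analysis.FluidPDE.IsMaxEnstrophyAttained ν E Z T ∨ ∃ γ₀ : NNReal, 0 < γ₀ ∧ ∀ ε : ℝ, 0 < ε → ∃ (J : ℕ) (D : Literature.Analysis.FluidPDE.ProfileSplitData J), Literature.Analysis.FluidPDE.IsProfileSplitSequence ν E Z T ε D ∧ Filter.Tendsto (fun n => Literature.Analysis.FluidPDE.eWeakGradL2Sq (D.u n (D.t n))) Filter.atTop (nhds (Literature.Analysis.FluidPDE.maxEnstrophy ν E Z T)) ∧ ∀ j, Literature.Analysis.FluidPDE.eWeakGradL2Sq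 (D.φ j) + γ₀ ≤ Z

/-- item stmt-NavierStokesRegularity-18665 · crux · rank 4 · open · by planner
why it might fail: an L³-small but Ḣ¹-large remainder is strained by the profiles' flow; enstrophy transfer profile → remainder over [0,T] need not vanish as ε → 0 (only a critical norm is small), so the peak may exceed the decoupled sum by O(1), not γ.
sources: Gallagher2001, Kato1984, KenigMerle2006, Gerard1998
[crux] V3 — at every finite level and for every γ > 0 there is ε > 0 such that along any
ε-profile-split sequence the peak enstrophy is asymptotically at most the sum of the pieces' maximal
enstrophies 𝒵(E, Z(φ_j), T) plus the remainders' enstrophy plus γ (card K3: nonlinear profile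
decomposition / asymptotic decoupling of far-apart profiles and an L³-small remainder in the
subcritical H¹ class). [deps: CompactnessDichotomy] [difficulty: L] -/
@[route_item "route-NavierStokesRegularity-ExtremalEnstrophy", crux]
def SplittingBound : Prop :=
  ∀ ν : ℝ, 0 < ν → ∀ (E Z : NNReal) (T : ℝ), 0 < E → 0 < Z → 0 < T → Literature.Analysis.FluidPDE.maxEnstrophy ν E Z T < ⊤ → ∀ γ : NNReal, 0 < γ → ∃ ε : ℝ, 0 < ε ∧ ∀ (J : ℕ) (D : Literature.Analysis.FluidPDE.ProfileSplitData J), Literature.Analysis.FluidPDE.IsProfileSplitSequence ν E Z T ε D → Filter.limsup (fun n => Literature.Analysis.FluidPDE.eWeakGradL2Sq (D.u n (D.t n))) Filter.atTop ≤ (∑ j, Literature.Analysis.FluidPDE.maxEnstrophy ν E (Literature.Analysis.FluidPDE.eWeakGradL2Sq (D.φ j)).toNNReal T) + Filter.limsup (fun n => Literature.Analysis.FluidPDE.eWeakGradL2Sq (D.r n)) Filter.atTop + γ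

/-- item stmt-NavierStokesRegularity-15607 · support · rank 9 · closed · proved by Summit.NavierStokesRegularity.NavierStokesRegularity.Theorems.continuousAlignment_noBlowupToClay_proof @ 75b41afd0230 (prover) · by planner
sources: FujitaKato1964, Kato1984, LemarieRieusset2016
[support] shared local-theory assembly (verbatim stmt-NavierStokesRegularity-0055, PROVED in tree by
Theorems.typeICertificateLadder_noBlowupToClay_proof): NoBlowup → Clay (A). [difficulty:
provable-now] -/
@[route_item "route-NavierStokesRegularity-ExtremalEnstrophy", crux]
def NoBlowupToClay : Prop :=
  (∀ (ν T : ℝ), 0 < ν → 0 < T → ∀ (u : ℝ → EuclideanSpace ℝ (Fin 3) → EuclideanSpace ℝ (Fin 3)) (p : ℝ → EuclideanSpace ℝ (Fin 3) → ℝ), Literature.Analysis.FluidPDE.IsClassicalNSSolutionOn (Set.Ico 0 T) ν 0 u p → Literature.Analysis.FluidPDE.IsLerayHopfOn T ν 0 (u 0) u → Literature.Analysis.FluidPDE.HasRapidSpatialDecay (u 0) → Literature.Analysis.FluidPDE.HasSmoothExtensionPast ν 0 u T) → NavierStokesRegularity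

/-- `NoBlowupToClay` holds: proved by `Summit.NavierStokesRegularity.NavierStokesRegularity.Theorems.continuousAlignment_noBlowupToClay_proof` @ 75b41afd0230. -/
theorem NoBlowupToClay_holds : NoBlowupToClay := _root_.Summit.NavierStokesRegularity.NavierStokesRegularity.Theorems.continuousAlignment_noBlowupToClay_proof

/-- item stmt-NavierStokesRegularity-18666 · support · rank 9 · closed · proved by Summit.NavierStokesRegularity.NavierStokesRegularity.Theorems.extremalEnstrophy_smallBudgetMonotone_proof (prover) · by planner
sources: FujitaKato1964, Kato1984, RobinsonRodrigoSadowski2016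
[support] S1 — small data: for every ν > 0 there is κ = κ(ν) > 0 such that E·Z ≤ κ implies 𝒵(E,Z,T)
≤ Z for all T (enstrophy is non-increasing for Leray–Hopf trajectories from data with ‖u₀‖₂‖∇u₀‖₂
small; weak–strong uniqueness). [difficulty: M] -/
@[route_item "route-NavierStokesRegularity-ExtremalEnstrophy", crux]
def SmallBudgetMonotone : Prop :=
  ∀ ν : ℝ, 0 < ν → ∃ κ : NNReal, 0 < κ ∧ ∀ (E Z : NNReal) (T : ℝ), E * Z ≤ κ → Literature.Analysis.FluidPDE.maxEnstrophy ν E Z T ≤ Z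

-- `SmallBudgetMonotone` holds: proved by `Summit.NavierStokesRegularity.NavierStokesRegularity.Theorems.extremalEnstrophy_smallBudgetMonotone_proof` (its module imports this route file, so no `_holds` link can be stated here).

/-- item stmt-NavierStokesRegularity-18667 · support · rank 9 · open · by planner
sources: KangYunProtas2020, RobinsonRodrigoSadowski2016, FujitaKato1964
[support] S2 — at a finite level, 𝒵(E, Z+δ, T) ≤ 𝒵(E,Z,T) + η for some δ = δ(η) > 0 (right upper
semicontinuity of the value function in the enstrophy budget; H¹ stability of the strong flow under
the a-priori bound given by finiteness of the level, plus the parabolic scaling 𝒵(E, λZ, T) = λ𝒵(λE,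
Z, λ²T)). [difficulty: M] -/
@[route_item "route-NavierStokesRegularity-ExtremalEnstrophy", crux]
def BudgetUpperSemicontinuity : Prop :=
  ∀ ν : ℝ, 0 < ν → ∀ (E Z : NNReal) (T : ℝ), 0 < E → 0 < T → Literature.Analysis.FluidPDE.maxEnstrophy ν E Z T < ⊤ → ∀ η : NNReal, 0 < η → ∃ δ : NNReal, 0 < δ ∧ Literature.Analysis.FluidPDE.maxEnstrophy ν E (Z + δ) T ≤ Literature.Analysis.FluidPDE.maxEnstrophy ν E Z T + η

/-- item stmt-NavierStokesRegularity-18668 · support · rank 9 · open · by planner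
sources: KangYunProtas2020, RobinsonRodrigoSadowski2016, FujitaKato1964
[support] S3 — every value below 𝒵(E,Z,T) is exceeded at some strictly smaller enstrophy budget Z' <
Z (left lower semicontinuity; shrink the datum of a near-maximising trajectory and use H¹ continuity
of the strong flow up to the observation time). [difficulty: M] -/
@[route_item "route-NavierStokesRegularity-ExtremalEnstrophy", crux]
def BudgetLowerSemicontinuity : Prop :=
  ∀ ν : ℝ, 0 < ν → ∀ (E Z : NNReal) (T : ℝ), 0 < E → 0 < T → 0 < Z → ∀ z < Literature.Analysis.FluidPDE.maxEnstrophy ν E Z T, ∃ Z' < Z, z < Literature.Analysis.FluidPDE.maxEnstrophy ν E Z' T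

/-- item stmt-NavierStokesRegularity-18669 · support · rank 9 · closed · proved by Summit.NavierStokesRegularity.NavierStokesRegularity.Theorems.extremalEnstrophy_enstrophyContinuation_proof (prover) · by planner
sources: FujitaKato1964, RobinsonRodrigoSadowski2016, LemarieRieusset2016
[support] S4 — a classical solution on [0,T) that is Leray–Hopf on [0,T] and has enstrophy bounded
on [0,T) extends smoothly past T (H¹ local theory with lifespan depending on the enstrophy only;
Serrin/weak–strong uniqueness). [difficulty: provable-now] -/
@[route_item "route-NavierStokesRegularity-ExtremalEnstrophy", crux]
def EnstrophyContinuation : Prop :=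
  ∀ (ν T : ℝ) (u : ℝ → EuclideanSpace ℝ (Fin 3) → EuclideanSpace ℝ (Fin 3)) (p : ℝ → EuclideanSpace ℝ (Fin 3) → ℝ), 0 < ν → 0 < T → Literature.Analysis.FluidPDE.IsClassicalNSSolutionOn (Set.Ico 0 T) ν 0 u p → Literature.Analysis.FluidPDE.IsLerayHopfOn T ν 0 (u 0) u → (∃ M : NNReal, ∀ t ∈ Set.Ico 0 T, Literature.Analysis.FluidPDE.eWeakGradL2Sq (u t) ≤ M) → Literature.Analysis.FluidPDE.HasSmoothExtensionPast ν 0 u T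

-- `EnstrophyContinuation` holds: proved by `Summit.NavierStokesRegularity.NavierStokesRegularity.Theorems.extremalEnstrophy_enstrophyContinuation_proof` (its module imports this route file, so no `_holds` link can be stated here).

/-- item stmt-NavierStokesRegularity-18670 · assembly · rank 1 · closed · proved by Summit.NavierStokesRegularity.NavierStokesRegularity.Theorems.extremalEnstrophy_assembly_proof (prover) · by planner
sources: KenigMerle2006, LuDoering2008
[assembly] MaximiserRigidity → CompactnessDichotomy → SplittingBound → SmallBudgetMonotone →
BudgetUpperSemicontinuity → BudgetLowerSemicontinuity → EnstrophyContinuation → NoBlowupToClay →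
NavierStokesRegularity (proved by `closes` in glue.lean). -/
@[route_item "route-NavierStokesRegularity-ExtremalEnstrophy"]
def Assembly : Prop :=
  MaximiserRigidity → CompactnessDichotomy → SplittingBound → SmallBudgetMonotone → BudgetUpperSemicontinuity → BudgetLowerSemicontinuity → EnstrophyContinuation → NoBlowupToClay → NavierStokesRegularity

-- `Assembly` holds: proved by `Summit.NavierStokesRegularity.NavierStokesRegularity.Theorems.extremalEnstrophy_assembly_proof` (its module imports this route file, so no `_holds` link can be stated here).

/-! D-0027 §2.1 — DECIDING THEOREM (planner-authored via `route open/edit --closes-file`; by planner-type-f5c3e9fad0-0 2026-08-17T16:55:31Z):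
its hypotheses are this route's items and its conclusion the sub-problem Statement (glue_lint), and it elaborates with this file. -/

/-- The deciding theorem of route ExtremalEnstrophy: the three cruxes and five supports give
Clay (A). Minimal-budget lemma `lt_top_of_budget_dichotomy` with `f Z = 𝒵_ν(E, Z, T)`,
`Φ = enstrophyMajorant C E`: attainment is excluded by `MaximiserRigidity`, splitting by
`SplittingBound` + `enstrophyMajorant_gap_coe`; hence `𝒵_ν(E, ·, T) < ∞`, which bounds the
enstrophy of every Leray–Hopf classical solution from Clay data (`eWeakGradL2Sq_le_maxEnstrophy`),
so `EnstrophyContinuation` extends it and `NoBlowupToClay` builds the Clay solution (every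
statement is uniform in the viscosity `ν > 0`). -/
@[closes "route-NavierStokesRegularity-ExtremalEnstrophy"] theorem closes (hV1 : CompactnessDichotomy) (hV2 : MaximiserRigidity) (hV3 : SplittingBound)
    (hS1 : SmallBudgetMonotone) (hS2 : BudgetUpperSemicontinuity)
    (hS3 : BudgetLowerSemicontinuity) (hS4 : EnstrophyContinuation)
    (hS5 : NoBlowupToClay) : NavierStokesRegularity := by
  classical
  refine hS5 ?_
  intro ν T hν hT u p hcl hLH hdec
  obtain ⟨C, hC1, hC⟩ := hV2 ν hν
  obtain ⟨κ, hκ, hsmallκ⟩ := hS1 ν hν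
  have hC0 : 0 < C := lt_of_lt_of_le one_pos hC1
  -- Step 1: the maximal enstrophy at viscosity ν is finite at every budget (horizon T).
  have hUB : ∀ E : NNReal, 0 < E → ∀ Z : NNReal, Literature.Analysis.FluidPDE.maxEnstrophy ν E Z T < ⊤ := by
    intro E hE
    have hz₀ : 0 < κ / E := div_pos hκ hE
    have hsmall : ∀ Z ≤ κ / E, Literature.Analysis.FluidPDE.maxEnstrophy ν E Z T ≤ (Literature.Analysis.FluidPDE.enstrophyMajorant C E Z : ENNReal) := by
      intro Z hZ
      have hEZ : E * Z ≤ κ := by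
        rw [mul_comm]; exact (le_div_iff₀ hE).mp hZ
      exact (hsmallκ E Z T hEZ).trans (by exact_mod_cast Literature.Analysis.FluidPDE.le_enstrophyMajorant hC1 E Z)
    have hA : ∀ Z : NNReal, 0 < Z → Literature.Analysis.FluidPDE.maxEnstrophy ν E Z T < ⊤ → Literature.Analysis.FluidPDE.IsMaxEnstrophyAttained ν E Z T →
        Literature.Analysis.FluidPDE.maxEnstrophy ν E Z T ≠ (Literature.Analysis.FluidPDE.enstrophyMajorant C E Z : ENNReal) := by
      intro Z hZ hfin hatt heq
      obtain ⟨T', u, t, htraj, hEu, hZu, h0, htT, htT', hmax⟩ := hatt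
      have hle := hC E Z T hE hZ hT hfin T' u t htraj hEu hZu h0 htT htT' hmax
      rw [hmax, heq] at hle
      have hpos : (Literature.Analysis.FluidPDE.enstrophyMajorant C E Z : ENNReal) ≠ 0 := by
        exact_mod_cast (Literature.Analysis.FluidPDE.enstrophyMajorant_pos (E := E) hC0 hZ).ne'
      exact absurd hle (not_le.mpr (ENNReal.half_lt_self hpos ENNReal.coe_ne_top))
    have hB : ∀ Z : NNReal, 0 < Z → Literature.Analysis.FluidPDE.maxEnstrophy ν E Z T < ⊤ →
        (∃ γ₀ : NNReal, 0 < γ₀ ∧ ∀ ε : ℝ, 0 < ε → ∃ (J : ℕ) (D : Literature.Analysis.FluidPDE.ProfileSplitData J),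
          Literature.Analysis.FluidPDE.IsProfileSplitSequence ν E Z T ε D ∧
          Tendsto (fun n => Literature.Analysis.FluidPDE.eWeakGradL2Sq (D.u n (D.t n))) atTop (𝓝 (Literature.Analysis.FluidPDE.maxEnstrophy ν E Z T)) ∧
          ∀ j, Literature.Analysis.FluidPDE.eWeakGradL2Sq (D.φ j) + γ₀ ≤ Z) →
        (∀ Z' < Z, Literature.Analysis.FluidPDE.maxEnstrophy ν E Z' T ≤ (Literature.Analysis.FluidPDE.enstrophyMajorant C E Z' : ENNReal)) →
        Literature.Analysis.FluidPDE.maxEnstrophy ν E Z T ≠ (Literature.Analysis.FluidPDE.enstrophyMajorant C E Z : ENNReal) := by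
      intro Z hZ hfin hsplit hbelow heq
      obtain ⟨γ₀, hγ₀, hfam⟩ := hsplit
      have hγ : 0 < Literature.Analysis.FluidPDE.enstrophyMargin C E Z γ₀ := Literature.Analysis.FluidPDE.enstrophyMargin_pos hC0 hE hZ hγ₀
      obtain ⟨ε, hε, hV3'⟩ := hV3 ν hν E Z T hE hZ hT hfin (Literature.Analysis.FluidPDE.enstrophyMargin C E Z γ₀) hγ
      obtain ⟨J, D, hD, hlim, hgain⟩ := hfam ε hε
      have h1 := hV3' J D hD
      rw [hlim.limsup_eq] at h1
      -- the pieces, as finite budgets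
      set Zs : Fin J → NNReal := fun j => (Literature.Analysis.FluidPDE.eWeakGradL2Sq (D.φ j)).toNNReal with hZsdef
      have hZj_le : ∀ j, Literature.Analysis.FluidPDE.eWeakGradL2Sq (D.φ j) ≤ Z := hD.eWeakGradL2Sq_profile_le
      have hZs : ∀ j, (Zs j : ENNReal) = Literature.Analysis.FluidPDE.eWeakGradL2Sq (D.φ j) := fun j =>
        ENNReal.coe_toNNReal (ne_top_of_le_ne_top ENNReal.coe_ne_top (hZj_le j))
      have hζ_le : limsup (fun n => Literature.Analysis.FluidPDE.eWeakGradL2Sq (D.r n)) atTop ≤ Z :=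
        le_add_self.trans hD.budget_orthogonal
      set ζ : NNReal := (limsup (fun n => Literature.Analysis.FluidPDE.eWeakGradL2Sq (D.r n)) atTop).toNNReal with hζdef
      have hζ : (ζ : ENNReal) = limsup (fun n => Literature.Analysis.FluidPDE.eWeakGradL2Sq (D.r n)) atTop :=
        ENNReal.coe_toNNReal (ne_top_of_le_ne_top ENNReal.coe_ne_top hζ_le)
      have hgain' : ∀ j, Zs j + γ₀ ≤ Z := by
        intro j
        have h := hgain j
        rw [← hZs j] at h
        exact_mod_cast h
      have hsum' : (∑ j, Zs j) + ζ ≤ Z := by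
        have h := hD.budget_orthogonal
        rw [← hζ, Finset.sum_congr rfl fun j _ => (hZs j).symm] at h
        exact_mod_cast h
      have hlt : ∀ j, Zs j < Z := fun j =>
        lt_of_lt_of_le (lt_add_of_pos_right _ hγ₀) (hgain' j)
      have h3 : (∑ j, Literature.Analysis.FluidPDE.maxEnstrophy ν E (Zs j) T) ≤ ∑ j, (Literature.Analysis.FluidPDE.enstrophyMajorant C E (Zs j) : ENNReal) :=
        Finset.sum_le_sum fun j _ => hbelow (Zs j) (hlt j)
      have h4 : (Literature.Analysis.FluidPDE.enstrophyMajorant C E Z : ENNReal) < Literature.Analysis.FluidPDE.enstrophyMajorant C E Z :=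
        calc (Literature.Analysis.FluidPDE.enstrophyMajorant C E Z : ENNReal) = Literature.Analysis.FluidPDE.maxEnstrophy ν E Z T := heq.symm
          _ ≤ (∑ j, Literature.Analysis.FluidPDE.maxEnstrophy ν E (Zs j) T) +
                limsup (fun n => Literature.Analysis.FluidPDE.eWeakGradL2Sq (D.r n)) atTop + (Literature.Analysis.FluidPDE.enstrophyMargin C E Z γ₀ : ENNReal) := h1
          _ ≤ (∑ j, (Literature.Analysis.FluidPDE.enstrophyMajorant C E (Zs j) : ENNReal)) + (ζ : ENNReal) +
                (Literature.Analysis.FluidPDE.enstrophyMargin C E Z γ₀ : ENNReal) := by rw [hζ]; gcongr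
          _ < Literature.Analysis.FluidPDE.enstrophyMajorant C E Z := Literature.Analysis.FluidPDE.enstrophyMajorant_gap_coe hC1 hE hZ hγ₀ hgain' hsum'
      exact lt_irrefl _ h4
    have key := Literature.Analysis.FluidPDE.lt_top_of_budget_dichotomy (f := fun Z => Literature.Analysis.FluidPDE.maxEnstrophy ν E Z T)
      (Φ := Literature.Analysis.FluidPDE.enstrophyMajorant C E) (A := fun Z => Literature.Analysis.FluidPDE.IsMaxEnstrophyAttained ν E Z T)
      (B := fun Z => ∃ γ₀ : NNReal, 0 < γ₀ ∧ ∀ ε : ℝ, 0 < ε → ∃ (J : ℕ) (D : Literature.Analysis.FluidPDE.ProfileSplitData J),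
          Literature.Analysis.FluidPDE.IsProfileSplitSequence ν E Z T ε D ∧
          Tendsto (fun n => Literature.Analysis.FluidPDE.eWeakGradL2Sq (D.u n (D.t n))) atTop (𝓝 (Literature.Analysis.FluidPDE.maxEnstrophy ν E Z T)) ∧
          ∀ j, Literature.Analysis.FluidPDE.eWeakGradL2Sq (D.φ j) + γ₀ ≤ Z)
      (fun Z Z' h => Literature.Analysis.FluidPDE.maxEnstrophy_mono le_rfl h le_rfl) (Literature.Analysis.FluidPDE.enstrophyMajorant_mono C E) hz₀ hsmall
      (fun Z hfin η hη => hS2 ν hν E Z T hE hT hfin η hη) (fun Z hZ => hS3 ν hν E Z T hE hT hZ)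
      (fun Z hZ hfin => hV1 ν hν E Z T hE hZ hT hfin) hA hB
    exact fun Z => (key Z).1
  -- Step 2: no blow-up for this solution: its enstrophy stays below 𝒵_ν(E₀, Z₀, T) < ∞.
  have h0 : (0 : ℝ) ∈ Set.Ico 0 T := ⟨le_rfl, hT⟩
  have hsm : ContDiff ℝ 1 (u 0) := (hcl.contDiff_velocity h0).of_le (by exact_mod_cast le_top)
  have htraj : Literature.Analysis.FluidPDE.IsLerayHopfTrajectory ν T u :=
    ⟨hT, Literature.Analysis.FluidPDE.VectorCalculus.IsDivFree.isWeaklyDivFree_holds (hcl.divFree 0 h0) hsm, hLH⟩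
  have hE0 : Literature.Analysis.FluidPDE.eEnergy (u 0) < ⊤ := by
    rw [Literature.Analysis.FluidPDE.eEnergy_eq_ofReal _ (hLH.memLp 0 ⟨le_rfl, hT.le⟩)]
    exact ENNReal.ofReal_lt_top
  have hZ0 : Literature.Analysis.FluidPDE.eWeakGradL2Sq (u 0) < ⊤ := by
    refine lt_of_le_of_lt (le_add_self.trans (Literature.Analysis.FluidPDE.eH1NormSq_le_of_contDiff hsm)) ?_
    refine ENNReal.add_lt_top.mpr ⟨hE0, ENNReal.mul_lt_top (by simp) ?_⟩
    exact hdec.lintegral_enorm_iteratedFDeriv_sq_lt_top 1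
  set E₀ : NNReal := (Literature.Analysis.FluidPDE.eEnergy (u 0)).toNNReal + 1 with hE₀
  set Z₀ : NNReal := (Literature.Analysis.FluidPDE.eWeakGradL2Sq (u 0)).toNNReal with hZ₀
  have hEle : Literature.Analysis.FluidPDE.eEnergy (u 0) ≤ E₀ := by
    rw [hE₀, ENNReal.coe_add, ENNReal.coe_toNNReal hE0.ne]
    exact le_self_add
  have hZle : Literature.Analysis.FluidPDE.eWeakGradL2Sq (u 0) ≤ Z₀ := (ENNReal.coe_toNNReal hZ0.ne).ge
  have hE₀pos : 0 < E₀ := add_pos_of_nonneg_of_pos zero_le one_pos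
  refine hS4 ν T u p hν hT hcl hLH ⟨(Literature.Analysis.FluidPDE.maxEnstrophy ν E₀ Z₀ T).toNNReal, fun t ht => ?_⟩
  rw [ENNReal.coe_toNNReal (hUB E₀ hE₀pos Z₀).ne]
  exact Literature.Analysis.FluidPDE.eWeakGradL2Sq_le_maxEnstrophy htraj hEle hZle ht.1 ht.2.le ht.2

end Summit.NavierStokesRegularity.NavierStokesRegularity.Theses.ExtremalEnstrophy
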